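import Literature.NumberTheory.GaloisRepresentations.CoeffDAction
import Literature.NumberTheory.PAdicHodge.FontaineDpstUnconditional
import HarnessLib

/-!
# Labelled Hodge–Tate weights of twists by a character with a period; Tate twists shift `HT_τ`

Topic `Literature/NumberTheory/GaloisRepresentations`; theorems only (no definition, no named fact).
Companion of the accepted `LabelledHodgeTateWeights` (`HT_τ(ρ)`,
`PeriodRingData.labelledHodgeTateWeights`; its module docstring lists "behaviour under twists" as
not yet treated), `CoeffDAction` (`PeriodRingData.baseActB`, the action of `B` on the right factor
of `M ⊗_P B`), `AdmissibleTwist` / `PstWeilDeligneTateTwist` (periods of characters, Tate twists of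
de Rham representations are de Rham) and `FontaineDpstUnconditional` (the period ring of THE pinned
`p`-adic Hodge datum IS `bdRPeriodRingData`, unconditionally).

## Mathematics

Let `𝔅 = (B, Γ ↷, F = B^Γ, Fil^•)` be a period-ring datum over the prime field `P`, `E ⊇ P` a
coefficient field, `ρ, ρ'` two `E`-linear representations of `Γ` on the same `E`-module `M` with
`ρ'(σ) = θ(σ) ρ(σ)` for a scalar function `θ : Γ → P` (a "twist of `ρ` by the character `θ`"),
and `u ∈ B` a nonzero **period** of `θ` (`θ(σ)·σ(u) = u`) such that multiplication by `u` shifts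
the filtration by `k`: `x ∈ Fil^{i+k} ↔ u x ∈ Fil^i`.  Then `Φ = id ⊗ (u ·)` is an `E`-linear
automorphism of `M ⊗_P B` with `Φ ∘ (ρ(σ) ⊗ σ) = (ρ'(σ) ⊗ σ) ∘ Φ`, commuting with `F`, and
`Φ(M ⊗ Fil^{i+k}) = M ⊗ Fil^i`; hence `Φ(D_τ(ρ)) = D_τ(ρ')`, `Φ(Fil^{i+k} D_τ(ρ)) = Fil^i D_τ(ρ')`
for every label `τ : F → E`, and

  **`HT_τ(ρ') = HT_τ(ρ) - k`** (`PeriodRingData.labelledHodgeTateWeights_of_period`).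

For Fontaine's `B_dR(F)` (`bdRPeriodRingData`, `Fil^i = ξ^i B_dR⁺ = t^i B_dR⁺`) and `θ = χ^j` the
`j`-th power of the cyclotomic character, `u = t^{-j}` is such a period with `k = j`
(`σ(t) = χ(σ) t`, `t^m Fil^i = Fil^{i+m}`), so **`HT_τ(ρ ⊗ χ^j) = HT_τ(ρ) - j`** for every
`E`-linear `ρ` (`labelledHodgeTateWeights_bdR_of_cyclotomic_zpow`): the labelled form, for
arbitrary `ρ`, of "`ℚ_p(1)` has Hodge–Tate weight `-1`" (Fontaine 1994, Exp. III §1.5;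
Barnet-Lamb–Gee–Geraghty–Taylor, Notation: `HT_τ(ε) = {-1}`, `HT_τ(W(1)) = HT_τ(W) - 1`;
Patrikis 2019, §2.7.1).  Since the period ring of THE pinned datum `fontainePst` /
`fontainePstAdicCompletion` is `bdRPeriodRingData` unconditionally
(`fontainePst_𝔅_eq_bdRPeriodRingData`), the same holds for the labelled weights the summit
statements use (`FramedGaloisRep.labelledHodgeTateWeightsAt … (fontainePstAdicCompletion v ℓ hv).𝔅`):
`FramedGaloisRep.labelledHodgeTateWeightsAt_twist_of_cyclotomic_zpow`.  In particular regularity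
(`Nodup`) of the labelled weights is invariant under Tate twists, and a Tate twist moves the
weights `{a, b}` of a rank-two `ρ` to `{0, b - a}` — the normalisation step "replace `ρ` by the
Tate twist with Hodge–Tate weights `0, k`" of Pan, arXiv:2209.06366, §7.2.1.

## Main results

* `jumpMultiset_comp_add` — translating a dimension function translates its jump multiset.
* `PeriodRingData.baseActB_coeffTensorRep_of_period`, `…baseActB_mem_labelD_of_period`,
  `…baseActB_mem_coeffFilTensor`, `…map_baseActB_labelFilD_of_period`,
  `…finrank_labelFilD_of_period`, `…labelledHodgeTateWeights_of_period` — the abstract twist.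
* `Literature.NumberTheory.PAdicHodge.tFrac_zpow_mul_mem_fil`, `…mem_fil_iff_tFrac_zpow_mul_mem` —
  `t^m Fil^i B_dR = Fil^{i+m} B_dR`.
* `Literature.NumberTheory.PAdicHodge.labelledHodgeTateWeights_bdR_of_cyclotomic_zpow`,
  `…fontainePst_labelledHodgeTateWeights_of_cyclotomic_zpow`,
  `…fontainePstAdicCompletion_labelledHodgeTateWeights_twist_of_cyclotomic_zpow`,
  `FramedGaloisRep.labelledHodgeTateWeightsAt_twist_of_cyclotomic_zpow`,
  `FramedGaloisRep.labelledHodgeTateWeightsAt_twist_nodup_iff_of_cyclotomic_zpow`.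

## References

* J.-M. Fontaine, *Représentations p-adiques semi-stables*, Astérisque 223 (1994), Exp. II §1.5.5
  (`σ t = χ(σ) t`, `Fil^i B_dR = t^i B_dR⁺`), Exp. III §1.5 and Prop. 1.5.2 (twists).
  [FontaineAsterisque223III]
* S. Patrikis, *Variations on a theorem of Tate*, Mem. AMS 258 (2019), §2.3.1, §2.7.1. [Patrikis2019]
* T. Barnet-Lamb, T. Gee, D. Geraghty, R. Taylor, Ann. of Math. 179 (2014), Introduction,
  Notation (`HT_τ(ε_l) = {-1}`). [BarnetlambEtAl2014]
* L. Pan, arXiv:2209.06366 (2022), §7.2.1 (the twist normalising the weights to `0, k`).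
  [Pan2022LocallyAnalyticII]
-/

noncomputable section

open scoped TensorProduct NumberField
open TensorProduct Field

namespace Literature.NumberTheory.GaloisRepresentations

/-! ### Translating a dimension function translates its jumps -/

section Jumps

/-- **Translating a dimension function translates its jump multiset**: the jumps of
`i ↦ d (i + k)` are the jumps of `d` moved by `-k`, with the same multiplicities (and the two jump
sets are finite together, so the junk value `0` is respected). [folklore] -/
theorem jumpMultiset_comp_add (d : ℤ → ℕ) (k : ℤ) :
    jumpMultiset (fun i => d (i + k)) = (jumpMultiset d).map (fun i => i - k) := by
  classical
  have hpre : {i : ℤ | d (i + 1 + k) < d (i + k)} = (fun i => i + k) ⁻¹' {j : ℤ | d (j + 1) < d j} := by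
    ext i
    simp only [Set.mem_setOf_eq, Set.mem_preimage, add_right_comm]
  by_cases h : {j : ℤ | d (j + 1) < d j}.Finite
  · have h' : {i : ℤ | d (i + 1 + k) < d (i + k)}.Finite := by
      rw [hpre]
      exact h.preimage (add_left_injective k).injOn
    refine Multiset.ext.2 fun i => ?_
    have hcount : ((jumpMultiset d).map (fun x => x - k)).count i = (jumpMultiset d).count (i + k) := by
      have hc := Multiset.count_map_eq_count' (fun x => x - k) (jumpMultiset d) sub_left_injective (i + k)
      simpa using hc
    rw [hcount, count_jumpMultiset (d := fun i => d (i + k)) h' i, count_jumpMultiset h (i + k)]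
    show d (i + k) - d (i + 1 + k) = d (i + k) - d (i + k + 1)
    rw [add_right_comm]
  · have h' : ¬ {i : ℤ | d (i + 1 + k) < d (i + k)}.Finite := fun h' => h (by
      rw [hpre] at h'
      exact h'.of_preimage fun j => ⟨j - k, sub_add_cancel j k⟩)
    rw [jumpMultiset_of_not_finite (d := fun i => d (i + k)) h', jumpMultiset_of_not_finite h,
      Multiset.map_zero]

end Jumps

/-! ### The abstract twist: a character with a period shifting the filtration -/

namespace PeriodRingData

universe u v v' w

variable {Γ : Type u} [Group Γ] [TopologicalSpace Γ] {P : Type v} {F : Type v'} [Field P]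
  [Field F] [Algebra P F]
  {E : Type*} [Field E] [Algebra P E] [TopologicalSpace E]
  {M : Type*} [AddCommGroup M] [Module E M] [Module P M] [IsScalarTower P E M]
  [TopologicalSpace M]
  (𝔅 : PeriodRingData.{u, v, v', w} Γ P F)

omit [TopologicalSpace Γ] [TopologicalSpace E] [TopologicalSpace M] in
/-- `id ⊗ (1 ·)` is the identity. [folklore] -/
theorem baseActB_one (x : M ⊗[P] 𝔅.B) : 𝔅.baseActB E M 1 x = x := by
  induction x using TensorProduct.induction_on with
  | zero => rw [map_zero]
  | tmul m b => rw [baseActB_tmul, one_mul]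
  | add x y hx hy => rw [map_add, hx, hy]

omit [TopologicalSpace Γ] [TopologicalSpace E] [TopologicalSpace M] in
/-- `id ⊗ (bc ·) = (id ⊗ (b ·)) ∘ (id ⊗ (c ·))`. [folklore] -/
theorem baseActB_mul (b c : 𝔅.B) (x : M ⊗[P] 𝔅.B) :
    𝔅.baseActB E M (b * c) x = 𝔅.baseActB E M b (𝔅.baseActB E M c x) := by
  induction x using TensorProduct.induction_on with
  | zero => simp only [map_zero]
  | tmul m b' => rw [baseActB_tmul, baseActB_tmul, baseActB_tmul, mul_assoc]
  | add x y hx hy => simp only [map_add, hx, hy]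

omit [TopologicalSpace Γ] [TopologicalSpace E] [TopologicalSpace M] in
/-- Multiplication by a unit on the right factor is injective. [folklore] -/
theorem baseActB_injective (u : 𝔅.Bˣ) : Function.Injective (𝔅.baseActB E M (u : 𝔅.B)) :=
  Function.LeftInverse.injective (g := 𝔅.baseActB E M ((u⁻¹ : 𝔅.Bˣ) : 𝔅.B)) fun x => by
    rw [← baseActB_mul, Units.inv_mul, baseActB_one]

omit [TopologicalSpace Γ] [TopologicalSpace E] [TopologicalSpace M] in
/-- **`id ⊗ (u ·)` maps `M ⊗ Fil^{i+k}` into `M ⊗ Fil^i`** when `u · Fil^{i+k} ⊆ Fil^i`. [folklore] -/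
theorem baseActB_mem_coeffFilTensor {u : 𝔅.B} {k : ℤ}
    (hfil : ∀ (i : ℤ) (x : 𝔅.B), x ∈ 𝔅.fil (i + k) → u * x ∈ 𝔅.fil i) {i : ℤ} {x : M ⊗[P] 𝔅.B}
    (hx : x ∈ 𝔅.coeffFilTensor E M (i + k)) : 𝔅.baseActB E M u x ∈ 𝔅.coeffFilTensor E M i := by
  obtain ⟨y, rfl⟩ := hx
  induction y using TensorProduct.induction_on with
  | zero => rw [map_zero, map_zero]; exact zero_mem _
  | tmul m b => exact ⟨m ⊗ₜ ⟨u * b, hfil i b b.2⟩, rfl⟩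
  | add x y hx hy => rw [map_add, map_add]; exact add_mem hx hy

variable (ρ ρ' : ContinuousRep Γ E M)

/-- **The intertwining identity.**  If `ρ'(σ) = θ(σ) ρ(σ)` and `u` is a period of `θ`
(`θ(σ)·σ(u) = u`), then `Φ = id ⊗ (u ·)` satisfies `Φ ∘ (ρ(σ) ⊗ σ) = (ρ'(σ) ⊗ σ) ∘ Φ` on
`M ⊗_P B`. [cite: FontaineAsterisque223III, Exp. III Prop. 1.5.2] -/
theorem baseActB_coeffTensorRep_of_period (θ : Γ → P) (hρ' : ∀ σ m, ρ' σ m = θ σ • ρ σ m)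
    {u : 𝔅.B} (hu : ∀ σ, algebraMap P 𝔅.B (θ σ) * σ • u = u) (σ : Γ) (x : M ⊗[P] 𝔅.B) :
    𝔅.baseActB E M u (𝔅.coeffTensorRep ρ σ x) = 𝔅.coeffTensorRep ρ' σ (𝔅.baseActB E M u x) := by
  induction x using TensorProduct.induction_on with
  | zero => simp only [map_zero]
  | tmul m b =>
    rw [coeffTensorRep_apply_tmul, baseActB_tmul, baseActB_tmul, coeffTensorRep_apply_tmul, hρ',
      smul_mul', TensorProduct.smul_tmul, Algebra.smul_def, ← mul_assoc, hu]
  | add x y hx hy => simp only [map_add, hx, hy]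

/-- `Φ = id ⊗ (u ·)` maps `D(ρ)` into `D(ρ')` (`u` a period of `θ`, `ρ' = θ ρ`).
[cite: FontaineAsterisque223III, Exp. III Prop. 1.5.2] -/
theorem baseActB_mem_coeffD_of_period (θ : Γ → P) (hρ' : ∀ σ m, ρ' σ m = θ σ • ρ σ m)
    {u : 𝔅.B} (hu : ∀ σ, algebraMap P 𝔅.B (θ σ) * σ • u = u) {x : M ⊗[P] 𝔅.B}
    (hx : x ∈ 𝔅.coeffD ρ) : 𝔅.baseActB E M u x ∈ 𝔅.coeffD ρ' := fun σ => by
  rw [← 𝔅.baseActB_coeffTensorRep_of_period ρ ρ' θ hρ' hu σ x, hx σ]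

/-- `Φ = id ⊗ (u ·)` maps the `τ`-component `D_τ(ρ)` into `D_τ(ρ')` (it commutes with the
`F`-action, `B` being commutative). [cite: Patrikis2019, §2.3.1] -/
theorem baseActB_mem_labelD_of_period (θ : Γ → P) (hρ' : ∀ σ m, ρ' σ m = θ σ • ρ σ m)
    {u : 𝔅.B} (hu : ∀ σ, algebraMap P 𝔅.B (θ σ) * σ • u = u) (τ : F →+* E) {x : M ⊗[P] 𝔅.B}
    (hx : x ∈ 𝔅.labelD ρ τ) : 𝔅.baseActB E M u x ∈ 𝔅.labelD ρ' τ :=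
  ⟨𝔅.baseActB_mem_coeffD_of_period ρ ρ' θ hρ' hu hx.1, fun f => by
    rw [← baseActB_baseAct, hx.2 f, map_smul]⟩

/-- **`Φ(Fil^{i+k} D_τ(ρ)) = Fil^i D_τ(ρ')`** for `Φ = id ⊗ (u ·)`, `u` a nonzero period of `θ`
with `x ∈ Fil^{i+k} ↔ u x ∈ Fil^i`, `ρ' = θ ρ` (apply the one-sided inclusions to `(ρ, ρ', u, k)`
and to `(ρ', ρ, u⁻¹, -k)`; a nonzero period is a unit, Fontaine's regularity (iii)).
[cite: FontaineAsterisque223III, Exp. III §1.4 and Prop. 1.5.2] -/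
theorem map_baseActB_labelFilD_of_period (θ : Γ → P) (hρ' : ∀ σ m, ρ' σ m = θ σ • ρ σ m)
    {u : 𝔅.B} (hu0 : u ≠ 0) (hu : ∀ σ, algebraMap P 𝔅.B (θ σ) * σ • u = u) {k : ℤ}
    (hfil : ∀ (i : ℤ) (x : 𝔅.B), x ∈ 𝔅.fil (i + k) ↔ u * x ∈ 𝔅.fil i) (τ : F →+* E) (i : ℤ) :
    (𝔅.labelFilD ρ τ (i + k)).map (𝔅.baseActB E M u) = 𝔅.labelFilD ρ' τ i := by
  have hθ : ∀ σ, θ σ ≠ 0 := 𝔅.ne_zero_of_period hu0 hu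
  obtain ⟨w, rfl⟩ := 𝔅.isUnit_of_period hu0 hu
  -- the reversed data `(ρ', ρ, w⁻¹, -k)`
  have hρ : ∀ σ m, ρ σ m = (θ σ)⁻¹ • ρ' σ m := fun σ m => by
    rw [hρ', smul_smul, inv_mul_cancel₀ (hθ σ), one_smul]
  have hu' : ∀ σ, algebraMap P 𝔅.B (θ σ)⁻¹ * σ • ((w⁻¹ : 𝔅.Bˣ) : 𝔅.B) = (w⁻¹ : 𝔅.Bˣ) := by
    obtain ⟨s', -, hs'1, hs'⟩ := 𝔅.exists_period_inv hu0 hu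
    have hs'eq : s' = ((w⁻¹ : 𝔅.Bˣ) : 𝔅.B) := by
      rw [← one_mul s', ← w.inv_mul, mul_assoc, hs'1, mul_one]
    rw [← hs'eq]
    exact hs'
  have hfil' : ∀ (i : ℤ) (x : 𝔅.B), x ∈ 𝔅.fil (i + -k) → ((w⁻¹ : 𝔅.Bˣ) : 𝔅.B) * x ∈ 𝔅.fil i := by
    intro i x hx
    have h := (hfil (i + -k) (((w⁻¹ : 𝔅.Bˣ) : 𝔅.B) * x)).2
    rw [← mul_assoc, Units.mul_inv, one_mul, neg_add_cancel_right] at h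
    exact h hx
  apply le_antisymm
  · rintro _ ⟨x, hx, rfl⟩
    exact ⟨𝔅.baseActB_mem_labelD_of_period ρ ρ' θ hρ' hu τ hx.1,
      𝔅.baseActB_mem_coeffFilTensor (fun i x hx => (hfil i x).1 hx) hx.2⟩
  · intro y hy
    refine ⟨𝔅.baseActB E M ((w⁻¹ : 𝔅.Bˣ) : 𝔅.B) y, ⟨?_, ?_⟩, ?_⟩
    · exact 𝔅.baseActB_mem_labelD_of_period ρ' ρ (fun σ => (θ σ)⁻¹) hρ hu' τ hy.1
    · have hy2 : y ∈ 𝔅.coeffFilTensor E M (i + k + -k) := by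
        rw [add_neg_cancel_right]; exact hy.2
      exact 𝔅.baseActB_mem_coeffFilTensor hfil' hy2
    · rw [← baseActB_mul, Units.mul_inv, baseActB_one]

/-- **`dim_E Fil^{i+k} D_τ(ρ) = dim_E Fil^i D_τ(ρ')`** (the linear isomorphism `Φ = id ⊗ (u ·)`).
[cite: FontaineAsterisque223III, Exp. III Prop. 1.5.2] -/
theorem finrank_labelFilD_of_period (θ : Γ → P) (hρ' : ∀ σ m, ρ' σ m = θ σ • ρ σ m)
    {u : 𝔅.B} (hu0 : u ≠ 0) (hu : ∀ σ, algebraMap P 𝔅.B (θ σ) * σ • u = u) {k : ℤ}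
    (hfil : ∀ (i : ℤ) (x : 𝔅.B), x ∈ 𝔅.fil (i + k) ↔ u * x ∈ 𝔅.fil i) (τ : F →+* E) (i : ℤ) :
    Module.finrank E (𝔅.labelFilD ρ τ (i + k)) = Module.finrank E (𝔅.labelFilD ρ' τ i) := by
  obtain ⟨w, hw⟩ := 𝔅.isUnit_of_period hu0 hu
  have hinj : Function.Injective (𝔅.baseActB E M u) := hw ▸ 𝔅.baseActB_injective w
  exact ((Submodule.equivMapOfInjective _ hinj _).trans
    (LinearEquiv.ofEq _ _ (𝔅.map_baseActB_labelFilD_of_period ρ ρ' θ hρ' hu0 hu hfil τ i))).finrank_eq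

/-- **Labelled Hodge–Tate weights of a twist by a character with a period.**  Let `ρ, ρ'` be
`E`-linear representations of `Γ` on `M` with `ρ'(σ) = θ(σ) ρ(σ)` for a scalar function
`θ : Γ → P`, and let `u ∈ B` be a nonzero period of `θ` (`θ(σ)·σ(u) = u`) such that
`x ∈ Fil^{i+k} B ↔ u x ∈ Fil^i B` for all `i`.  Then for every label `τ : F → E`,
`HT_τ(ρ') = HT_τ(ρ) - k` (each weight moved by `-k`, multiplicities kept).  For `B = B_dR`,
`θ = χ^j`, `u = t^{-j}`, `k = j`: `HT_τ(ρ ⊗ χ^j) = HT_τ(ρ) - j`.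
[cite: FontaineAsterisque223III, Exp. III Prop. 1.5.2] [cite: Patrikis2019, §2.7.1]
[cite: BarnetlambEtAl2014, Introduction (Notation)] -/
theorem labelledHodgeTateWeights_of_period (θ : Γ → P) (hρ' : ∀ σ m, ρ' σ m = θ σ • ρ σ m)
    {u : 𝔅.B} (hu0 : u ≠ 0) (hu : ∀ σ, algebraMap P 𝔅.B (θ σ) * σ • u = u) {k : ℤ}
    (hfil : ∀ (i : ℤ) (x : 𝔅.B), x ∈ 𝔅.fil (i + k) ↔ u * x ∈ 𝔅.fil i) (τ : F →+* E) :
    𝔅.labelledHodgeTateWeights ρ' τ = (𝔅.labelledHodgeTateWeights ρ τ).map (fun i => i - k) := by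
  rw [labelledHodgeTateWeights_def, labelledHodgeTateWeights_def, ← jumpMultiset_comp_add]
  refine congrArg jumpMultiset (funext fun i => ?_)
  exact (𝔅.finrank_labelFilD_of_period ρ ρ' θ hρ' hu0 hu hfil τ i).symm

end PeriodRingData

end Literature.NumberTheory.GaloisRepresentations

/-! ### Fontaine's `B_dR`: `t^m Fil^i = Fil^{i+m}` and the weights of Tate twists -/

namespace Literature.NumberTheory.PAdicHodge

open ValuativeRel WittVector
open Literature.NumberTheory.GaloisRepresentations
open Literature.NumberTheory.GaloisRepresentations.IsNonarchimedeanLocalField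

section BdR

variable {F : Type} [Field F] [ValuativeRel F] [TopologicalSpace F] [IsNonarchimedeanLocalField F]
  [CharZero F] {p : ℕ} [Fact p.Prime] [Fact (¬ IsUnit (p : integerC F))]
  [IsAdicComplete (Ideal.span {(p : integerC F)}) (integerC F)]
  [IsDomain (BDeRhamPlus (integerC F) p)]
  (hp : valuation F p < 1) (hF : Function.Surjective (fontaineTheta (integerC F) p))

/-- **`t^m · Fil^i B_dR ⊆ Fil^{i+m} B_dR`** (`m ∈ ℤ`; `t = ξ · unit` in `B_dR⁺`, `Fil^i = ξ^i B_dR⁺`).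
[cite: FontaineAsterisque223III, Exp. II §1.5.5] -/
theorem tFrac_zpow_mul_mem_fil (m i : ℤ) {x : FracBdR F p}
    (hx : letI := fracAlgebra (p := p) hp hF; x ∈ fil hp hF i) :
    letI := fracAlgebra (p := p) hp hF; (tFrac : FracBdR F p) ^ m * x ∈ fil hp hF (i + m) := by
  rw [mem_fil_iff] at hx ⊢
  obtain ⟨b, rfl⟩ := hx
  obtain ⟨w, hw, htw⟩ := exists_tBdR_eq_xiBdR_mul (F := F) (p := p) hF
  refine ⟨(hw.unit ^ m : (BDeRhamPlus (integerC F) p)ˣ) * b, ?_⟩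
  rw [map_mul, algebraMap_units_zpow, IsUnit.unit_spec, zpow_add₀ (algebraMap_xiBdR_ne_zero hF),
    tFrac_def, htw, map_mul, mul_zpow]
  ring

/-- **`x ∈ Fil^i B_dR ↔ t^m x ∈ Fil^{i+m} B_dR`.** [cite: FontaineAsterisque223III, Exp. II §1.5.5] -/
theorem mem_fil_iff_tFrac_zpow_mul_mem (m i : ℤ) (x : FracBdR F p) :
    (letI := fracAlgebra (p := p) hp hF; x ∈ fil hp hF i) ↔
      letI := fracAlgebra (p := p) hp hF; (tFrac : FracBdR F p) ^ m * x ∈ fil hp hF (i + m) := by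
  refine ⟨tFrac_zpow_mul_mem_fil hp hF m i, fun h => ?_⟩
  have h' := tFrac_zpow_mul_mem_fil hp hF (-m) (i + m) h
  rwa [← mul_assoc, ← zpow_add₀ (tFrac_ne_zero hF), neg_add_cancel, zpow_zero, one_mul,
    add_neg_cancel_right] at h'

end BdR

section Datum

variable {F : Type} [Field F] [ValuativeRel F] [TopologicalSpace F] [IsNonarchimedeanLocalField F]
  [CharZero F] {p : ℕ} [Fact p.Prime]

/-- **Tate twists shift the labelled Hodge–Tate weights, for Fontaine's `B_dR(F)`.**  For the datum
`bdRPeriodRingData hp` (any `ℚ_p`-algebra structure on `F`, all equal to the canonical one), two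
`E`-linear representations `ρ, ρ'` of `Γ_F` on `M` with `ρ'(σ) = χ(σ)^j ρ(σ)` (`χ` the `p`-adic
cyclotomic character, `j ∈ ℤ`) and any label `τ : F → E`:  `HT_τ(ρ') = HT_τ(ρ) - j`.  Proof:
`t^{-j} = (t⁻¹)^j` is a nonzero period of `χ^j` (`t⁻¹` is one of `χ`, accepted
`bdRPeriodRingData_period`) and `x ∈ Fil^{i+j} ↔ t^{-j} x ∈ Fil^i`.
[cite: FontaineAsterisque223III, Exp. II §1.5.5 and Exp. III Prop. 1.5.2]
[cite: BarnetlambEtAl2014, Introduction (Notation)] -/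
theorem labelledHodgeTateWeights_bdR_of_cyclotomic_zpow [Fact (¬ IsUnit (p : integerC F))]
    [IsAdicComplete (Ideal.span {(p : integerC F)}) (integerC F)] [Algebra ℚ_[p] F]
    (hp : valuation F p < 1)
    (halg : ∀ c : ℚ_[p], algebraMap ℚ_[p] F c = LocalField.padicRingHom F p hp c)
    {E : Type*} [Field E] [Algebra ℚ_[p] E] [TopologicalSpace E]
    {M : Type*} [AddCommGroup M] [Module E M] [Module ℚ_[p] M] [IsScalarTower ℚ_[p] E M]
    [TopologicalSpace M] (ρ ρ' : ContinuousRep (absoluteGaloisGroup F) E M) (j : ℤ)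
    (hρ' : ∀ σ m, ρ' σ m =
      ((((GaloisRep.cyclotomicCharacter F p σ : ℤ_[p]ˣ) : ℤ_[p]) : ℚ_[p]) ^ j) • ρ σ m)
    (τ : F →+* E) :
    (bdRPeriodRingData (F := F) (p := p) hp).labelledHodgeTateWeights ρ' τ =
      ((bdRPeriodRingData (F := F) (p := p) hp).labelledHodgeTateWeights ρ τ).map
        (fun i => i - j) := by
  have hF : Function.Surjective (fontaineTheta (integerC F) p) := surjective_fontaineTheta_integerC hp
  haveI := isDomain_bDeRhamPlus (F := F) (p := p) hF
  -- `t⁻¹`, a nonzero period of `χ`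
  have ht0 : (show (bdRPeriodRingData (F := F) (p := p) hp).B from
      ((tFrac : FracBdR F p)⁻¹ : FracBdR F p)) ≠ 0 :=
    inv_ne_zero (tFrac_ne_zero hF)
  have hper : ∀ σ : absoluteGaloisGroup F,
      algebraMap ℚ_[p] (bdRPeriodRingData (F := F) (p := p) hp).B
          (((GaloisRep.cyclotomicCharacter F p σ : ℤ_[p]ˣ) : ℤ_[p]) : ℚ_[p]) *
        σ • (show (bdRPeriodRingData (F := F) (p := p) hp).B from
          ((tFrac : FracBdR F p)⁻¹ : FracBdR F p)) =
        (show (bdRPeriodRingData (F := F) (p := p) hp).B from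
          ((tFrac : FracBdR F p)⁻¹ : FracBdR F p)) := fun σ => by
    have h := bdRPeriodRingData_period hp halg σ
    rwa [PeriodRingData.chi, cyclotomicRepQp_apply, mul_one] at h
  obtain ⟨w, hw⟩ := (bdRPeriodRingData (F := F) (p := p) hp).isUnit_of_period ht0 hper
  -- `(t⁻¹)^j = t^{-j}`, a nonzero period of `χ^j`
  have hwj := (bdRPeriodRingData (F := F) (p := p) hp).period_zpow
    (θ := fun σ => (((GaloisRep.cyclotomicCharacter F p σ : ℤ_[p]ˣ) : ℤ_[p]) : ℚ_[p])) (u := w)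
    (fun σ => by rw [hw]; exact hper σ) j
  -- `↑(w ^ j) = (t⁻¹)^j = t^{-j}`, read in `B_dR = Frac B_dR⁺` (where `zpow` lives)
  have h1 : (show FracBdR F p from ((w ^ j : (bdRPeriodRingData (F := F) (p := p) hp).Bˣ) :
        (bdRPeriodRingData (F := F) (p := p) hp).B)) =
      (show FracBdR F p from ((w : (bdRPeriodRingData (F := F) (p := p) hp).Bˣ) :
        (bdRPeriodRingData (F := F) (p := p) hp).B)) ^ j :=
    Units.val_zpow_eq_zpow_val (α := FracBdR F p) (show (FracBdR F p)ˣ from w) j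
  have h2 : (show FracBdR F p from ((w : (bdRPeriodRingData (F := F) (p := p) hp).Bˣ) :
        (bdRPeriodRingData (F := F) (p := p) hp).B)) = (tFrac : FracBdR F p)⁻¹ := hw
  have hfil : ∀ (i : ℤ) (x : (bdRPeriodRingData (F := F) (p := p) hp).B),
      x ∈ (bdRPeriodRingData (F := F) (p := p) hp).fil (i + j) ↔
        ((w ^ j : (bdRPeriodRingData (F := F) (p := p) hp).Bˣ) :
            (bdRPeriodRingData (F := F) (p := p) hp).B) * x ∈
          (bdRPeriodRingData (F := F) (p := p) hp).fil i := by
    intro i x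
    have h := mem_fil_iff_tFrac_zpow_mul_mem hp hF (-j) (i + j) x
    rw [add_neg_cancel_right, ← inv_zpow', ← h2, ← h1] at h
    exact h
  exact (bdRPeriodRingData (F := F) (p := p) hp).labelledHodgeTateWeights_of_period ρ ρ'
    (fun σ => (((GaloisRep.cyclotomicCharacter F p σ : ℤ_[p]ˣ) : ℤ_[p]) : ℚ_[p]) ^ j) hρ'
    (Units.ne_zero _) hwj hfil τ

/-- **… hence for THE pinned datum `fontainePst F p hp` — unconditionally** (its period ring IS
`bdRPeriodRingData`, `fontainePst_𝔅_eq_bdRPeriodRingData`; its `ℚ_p`-structure is the canonical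
one): `HT_τ(ρ') = HT_τ(ρ) - j` whenever `ρ'(σ) = χ(σ)^j ρ(σ)`.
[cite: FontaineAsterisque223III, Exp. III Prop. 1.5.2] [cite: BarnetlambEtAl2014, Introduction (Notation)] -/
theorem fontainePst_labelledHodgeTateWeights_of_cyclotomic_zpow (hp : valuation F p < 1)
    {E : Type*} [Field E] [Algebra ℚ_[p] E] [TopologicalSpace E]
    {M : Type*} [AddCommGroup M] [Module E M] [Module ℚ_[p] M] [IsScalarTower ℚ_[p] E M]
    [TopologicalSpace M] (ρ ρ' : ContinuousRep (absoluteGaloisGroup F) E M) (j : ℤ)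
    (hρ' : ∀ σ m, ρ' σ m =
      ((((GaloisRep.cyclotomicCharacter F p σ : ℤ_[p]ˣ) : ℤ_[p]) : ℚ_[p]) ^ j) • ρ σ m)
    (τ : F →+* E) :
    letI := (fontainePst F p hp).algebra
    (fontainePst F p hp).𝔅.labelledHodgeTateWeights ρ' τ =
      ((fontainePst F p hp).𝔅.labelledHodgeTateWeights ρ τ).map (fun i => i - j) := by
  haveI : Fact (¬ IsUnit (p : integerC F)) := ⟨not_isUnit_natCast_integerC hp⟩
  haveI : IsAdicComplete (Ideal.span {(p : integerC F)}) (integerC F) :=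
    isAdicComplete_integerC_natCast hp
  letI := (fontainePst F p hp).algebra
  rw [fontainePst_𝔅_eq_bdRPeriodRingData hp]
  exact labelledHodgeTateWeights_bdR_of_cyclotomic_zpow hp (algebraMap_padic_eq_padicRingHom hp)
    ρ ρ' j hρ' τ

end Datum

/-! ### The summit's pinned datum at `v ∣ ℓ`: Tate twists of framed representations -/

section NumberField

open IsDedekindDomain

variable {K : Type} [Field K] [NumberField K] {ℓ : ℕ} [Fact ℓ.Prime] {n : ℕ}

/-- **Tate twists shift the labelled weights for the summit's pinned datum at `v ∣ ℓ` —
unconditionally.**  For `ρ : Γ_{K_v} →ₜ* GL_n(ℚ̄_ℓ)` and a continuous character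
`ε : Γ_{K_v} → ℚ̄_ℓˣ` with `ε(σ) = χ_ℓ(σ)^j` (`χ_ℓ` the cyclotomic character of `K_v`), the
`τ`-labelled Hodge–Tate weights of `ρ ⊗ ε` (`ρ.twist ε`) relative to
`(fontainePstAdicCompletion v ℓ hv).𝔅 = B_dR(K_v)` are those of `ρ` moved by `-j`.
[cite: FontaineAsterisque223III, Exp. III Prop. 1.5.2] [cite: BarnetlambEtAl2014, Introduction (Notation)] -/
theorem fontainePstAdicCompletion_labelledHodgeTateWeights_twist_of_cyclotomic_zpow
    (v : HeightOneSpectrum (𝓞 K)) (hv : ((ℓ : ℕ) : 𝓞 K) ∈ v.asIdeal)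
    (ρ : FramedRep (absoluteGaloisGroup (v.adicCompletion K)) (PadicAlgCl ℓ) n) (j : ℤ)
    (ε : absoluteGaloisGroup (v.adicCompletion K) →ₜ* (PadicAlgCl ℓ)ˣ)
    (hε : ∀ σ, (ε σ : PadicAlgCl ℓ) =
      (algebraMap ℚ_[ℓ] (PadicAlgCl ℓ)
        ((GaloisRep.cyclotomicCharacter (v.adicCompletion K) ℓ σ : ℤ_[ℓ]ˣ) : ℤ_[ℓ])) ^ j)
    (τ : v.adicCompletion K →+* PadicAlgCl ℓ) :
    letI := (fontainePstAdicCompletion v ℓ hv).algebra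
    (fontainePstAdicCompletion v ℓ hv).𝔅.labelledHodgeTateWeights
        (FramedRep.toContinuousRep (ρ.twist ε)) τ =
      ((fontainePstAdicCompletion v ℓ hv).𝔅.labelledHodgeTateWeights
        (FramedRep.toContinuousRep ρ) τ).map (fun i => i - j) := by
  haveI := LocalField.charZero_adicCompletion v
  refine fontainePst_labelledHodgeTateWeights_of_cyclotomic_zpow _
    (FramedRep.toContinuousRep ρ) (FramedRep.toContinuousRep (ρ.twist ε)) j (fun σ m => ?_) τ
  rw [FramedRep.toContinuousRep_apply_apply, FramedRep.toContinuousRep_apply_apply,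
    FramedRep.coe_twist_apply, Matrix.smul_mulVec, hε, ← map_zpow₀, algebraMap_smul]

end NumberField

end Literature.NumberTheory.PAdicHodge

namespace Literature.NumberTheory.GaloisRepresentations

namespace FramedGaloisRep

open IsDedekindDomain Literature.NumberTheory.PAdicHodge

variable {K : Type} [Field K] [NumberField K] {ℓ : ℕ} [Fact ℓ.Prime] {n : ℕ}

/-- **Tate twists shift the labelled Hodge–Tate weights of the summit statements**
(`labelledHodgeTateWeightsAt` for THE pinned datum `fontainePstAdicCompletion v ℓ hv` at a place
`v ∣ ℓ`, unconditionally).  Let `ρ : Γ_K →ₜ* GL_n(ℚ̄_ℓ)` and `ε : Γ_K → ℚ̄_ℓˣ` a continuous character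
whose restriction to `Γ_{K_v}` is `χ_ℓ^j`, `χ_ℓ` the cyclotomic character of `K_v`
(for the global `ℓ`-adic cyclotomic character this is the accepted
`cyclotomicCharacter_absGaloisRestrict`).  Then for every label `τ : K_v → ℚ̄_ℓ` the `τ`-labelled
Hodge–Tate weights of `ρ ⊗ ε` at `v` are those of `ρ` moved by `-j`:
`HT_τ((ρ ⊗ ε)|_{Γ_{K_v}}) = HT_τ(ρ|_{Γ_{K_v}}) - j`.
[cite: FontaineAsterisque223III, Exp. III Prop. 1.5.2] [cite: BarnetlambEtAl2014, Introduction (Notation)]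
[cite: Pan2022LocallyAnalyticII, §7.2.1] -/
theorem labelledHodgeTateWeightsAt_twist_of_cyclotomic_zpow (ρ : FramedGaloisRep K (PadicAlgCl ℓ) n)
    (ε : absoluteGaloisGroup K →ₜ* (PadicAlgCl ℓ)ˣ) (j : ℤ) (v : HeightOneSpectrum (𝓞 K))
    (hv : ((ℓ : ℕ) : 𝓞 K) ∈ v.asIdeal)
    (hε : ∀ σ : absoluteGaloisGroup (v.adicCompletion K),
      (ε (absGaloisRestrict K (v.adicCompletion K) σ) : PadicAlgCl ℓ) =
        (algebraMap ℚ_[ℓ] (PadicAlgCl ℓ)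
          ((GaloisRep.cyclotomicCharacter (v.adicCompletion K) ℓ σ : ℤ_[ℓ]ˣ) : ℤ_[ℓ])) ^ j)
    (τ : v.adicCompletion K →+* PadicAlgCl ℓ) :
    labelledHodgeTateWeightsAt (FramedRep.twist ρ ε) v
        (fontainePstAdicCompletion v ℓ hv).algebra (fontainePstAdicCompletion v ℓ hv).𝔅 τ =
      (ρ.labelledHodgeTateWeightsAt v (fontainePstAdicCompletion v ℓ hv).algebra
        (fontainePstAdicCompletion v ℓ hv).𝔅 τ).map (fun i => i - j) := by
  rw [labelledHodgeTateWeightsAt_def, labelledHodgeTateWeightsAt_def]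
  exact fontainePstAdicCompletion_labelledHodgeTateWeights_twist_of_cyclotomic_zpow v hv
    (ρ.toLocal v) j (ε.comp (absGaloisRestrict K (v.adicCompletion K))) hε τ

/-- **Regularity of the labelled weights at `v ∣ ℓ` is invariant under Tate twists** (a translate
of a multiset is multiplicity-free iff the multiset is). [folklore] -/
theorem labelledHodgeTateWeightsAt_twist_nodup_iff_of_cyclotomic_zpow
    (ρ : FramedGaloisRep K (PadicAlgCl ℓ) n) (ε : absoluteGaloisGroup K →ₜ* (PadicAlgCl ℓ)ˣ) (j : ℤ)
    (v : HeightOneSpectrum (𝓞 K)) (hv : ((ℓ : ℕ) : 𝓞 K) ∈ v.asIdeal)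
    (hε : ∀ σ : absoluteGaloisGroup (v.adicCompletion K),
      (ε (absGaloisRestrict K (v.adicCompletion K) σ) : PadicAlgCl ℓ) =
        (algebraMap ℚ_[ℓ] (PadicAlgCl ℓ)
          ((GaloisRep.cyclotomicCharacter (v.adicCompletion K) ℓ σ : ℤ_[ℓ]ˣ) : ℤ_[ℓ])) ^ j)
    (τ : v.adicCompletion K →+* PadicAlgCl ℓ) :
    (labelledHodgeTateWeightsAt (FramedRep.twist ρ ε) v
        (fontainePstAdicCompletion v ℓ hv).algebra (fontainePstAdicCompletion v ℓ hv).𝔅 τ).Nodup ↔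
      (ρ.labelledHodgeTateWeightsAt v (fontainePstAdicCompletion v ℓ hv).algebra
        (fontainePstAdicCompletion v ℓ hv).𝔅 τ).Nodup := by
  rw [ρ.labelledHodgeTateWeightsAt_twist_of_cyclotomic_zpow ε j v hv hε τ]
  exact Multiset.nodup_map_iff_of_injective sub_left_injective

end FramedGaloisRep

end Literature.NumberTheory.GaloisRepresentations

end
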